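import Summits.BirchSwinnertonDyer.BirchSwinnertonDyer.Theorems.GoldfeldAllTwistsTwoConverseTwinAdditiveTwoAdicDualThreeModEightPFive
import Summits.BirchSwinnertonDyer.BirchSwinnertonDyer.Theorems.GoldfeldAllTwistsTwoConverseTwinOddTwoPrimesTwistSelmerDualPlusPFiveAlpha
import Summits.BirchSwinnertonDyer.BirchSwinnertonDyer.Theorems.GoldfeldAllTwistsTwoConverseTwinAdditiveTwoPrimesTwistSelmerDualPlusPOneAlpha
import HarnessLib

set_option linter.dupNamespace false -- namespace `…BirchSwinnertonDyer.BirchSwinnertonDyer…` is the cell's (D-0017 nested layout)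
set_option autoImplicit false

/-!
# OBJECT A3⁺ tranche F-I, file F0: `…TwinAdditiveTwoPrimesTwistSelmerDualLocalThreeModEightPFiveAlpha` — the LOCAL KILLS the a35+ dual Selmer file F1 needs
# beyond Fβ⁺-3's: the `2`-adic kills of the classes `p, −7p` of `S′ = S(84qp, −28q²p²)` on `(q, p) ≡ (3, 5) (mod 8)` (type-free) and the `p`-adic
# TYPE-α kills of the classes `2p, −14p` at `p ≡ 5 (8)` (root-freeness of `Q₅`, `Q₆`)

Cell `bsd-goldfeld`, seat `bsd-goldfeld-s1p-c3x` (gen 17); planner ORDER (cdvi) «A3⁺-F», tranche F-I (kill table kit j328674 / `scoping/kills_a3x_plus_15000.txt`: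
on a35+ the dual classes `p, −7p` die ONLY at `2`; on b35+ they also die at `2` — Fβ⁺-3 killed them by the type-β root test at `p` instead, which type α
does not afford). The `(3, 5)` companion of Fβ⁺-0c `…TwinAdditiveTwoAdicDualThreeModEightPFive` (classes `−q, 7q, −2qp, 14qp`), SAME engine:
common factor `p ↦ 5` (`p ≡ 5 (8)`), then square factor `q ↦ 3` (`q ≡ 3 (8)`), onto the NEW numerics `(1260; 5, −1260)` (class `p`: `d = p`,
`d′ = −28q²p`) and `(1260; −35, 180)` (class `−7p`: `d = −7p`, `d′ = 4q²p`), both charts dying modulo `2⁵` (`decide`). §3: the type-α kills at `p` of the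
classes `2p` (`e = 2`, `e′ = −14q²`) and `−14p` (`e = −14`, `e′ = 2q²`): a square root `T = X²` of the reduced quadratic `e′T² + 84qT + e` gives the root
`Z = irX` (`r² = q`, `i² = −1` mod `p`) of `Q₅ = 7Z⁴ + 42Z² − 1`, resp. `Q₆ = Z⁴ − 42Z² − 7`, root-free mod `p` in type α at `p ≡ 5 (8)` by a75+'s
`rootfree_Q5_Q6_of_alpha_five` (in tree) — the pattern of a71+'s `not_isSoluble_padic_typeAlpha_class_P_plus`.
`--supports stmt-BirchSwinnertonDyer-19140` as a HELPER. Theses-free; theorems only; no definition, no fact binder, no `sorry`. FRONTIER-grade: a twist-density-ZERO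
sub-family; never distance-to-summit. HONEST FRAMING: local lemmas only; no Selmer group is bounded in this file; items 19140 / 19350 / 20044 unchanged;
BSD is not proved by any of this.

References: [SilvermanAEC2009] Prop. X.4.9, Example X.4.10; [Serre1973] Ch. II §3.3 Thm 4; [CoatesLiTianZhai2015] §5.
-/

noncomputable section

open scoped Classical

open WeierstrassCurve Literature.NumberTheory.EllipticCurves

namespace Summit.BirchSwinnertonDyer.BirchSwinnertonDyer.Theorems.GoldfeldGoodTwists

/-! ## §1 The two numeric quartics die modulo `2⁵` in both charts -/

/-- `ℤ/2⁵` keys for `(1260; 5, −1260)`: both charts die modulo `32`. [folklore] -/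
private theorem keys_threeFive_P :
    (∀ T S : ZMod (2 ^ 5), S ^ 2 ≠ ((5 : ℤ) : ZMod (2 ^ 5)) + ((1260 : ℤ) : ZMod (2 ^ 5)) * T ^ 2 +
      ((-1260 : ℤ) : ZMod (2 ^ 5)) * T ^ 4) ∧
    (∀ T S : ZMod (2 ^ 5), S ^ 2 ≠ ((-1260 : ℤ) : ZMod (2 ^ 5)) + ((1260 : ℤ) : ZMod (2 ^ 5)) * T ^ 2 +
      ((5 : ℤ) : ZMod (2 ^ 5)) * T ^ 4) := by
  refine ⟨?_, ?_⟩ <;> decide +kernel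

/-- `ℤ/2⁵` keys for `(1260; −35, 180)`: both charts die modulo `32`. [folklore] -/
private theorem keys_threeFive_negSevenP :
    (∀ T S : ZMod (2 ^ 5), S ^ 2 ≠ ((-35 : ℤ) : ZMod (2 ^ 5)) + ((1260 : ℤ) : ZMod (2 ^ 5)) * T ^ 2 +
      ((180 : ℤ) : ZMod (2 ^ 5)) * T ^ 4) ∧
    (∀ T S : ZMod (2 ^ 5), S ^ 2 ≠ ((180 : ℤ) : ZMod (2 ^ 5)) + ((1260 : ℤ) : ZMod (2 ^ 5)) * T ^ 2 +
      ((-35 : ℤ) : ZMod (2 ^ 5)) * T ^ 4) := by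
  refine ⟨?_, ?_⟩ <;> decide +kernel

/-- **Numeric kill `(1260; 5, −1260)`**: `w² = 5u⁴ + 1260u²z² − 1260z⁴` has no non-trivial `ℚ₂`-point (both charts die modulo `2⁵`).
[cite: SilvermanAEC2009, Prop. X.4.9 and Example X.4.10] -/
theorem not_isSoluble_two_normalised_P_threeFive :
    ¬ ((twoIsogenyQuartic 1260 5 (-1260)).map (Int.castRingHom ℚ_[2])).IsSoluble := by
  obtain ⟨c, c'⟩ := keys_threeFive_P
  exact not_isSoluble_two_of_padicInt_charts (padicInt_two_sq_ne_of_zmodPow 5 c) (padicInt_two_sq_ne_of_zmodPow 5 c')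

/-- **Numeric kill `(1260; −35, 180)`**: `w² = −35u⁴ + 1260u²z² + 180z⁴` has no non-trivial `ℚ₂`-point (both charts die modulo `2⁵`).
[cite: SilvermanAEC2009, Prop. X.4.9 and Example X.4.10] -/
theorem not_isSoluble_two_normalised_negSevenP_threeFive :
    ¬ ((twoIsogenyQuartic 1260 (-35) 180).map (Int.castRingHom ℚ_[2])).IsSoluble := by
  obtain ⟨c, c'⟩ := keys_threeFive_negSevenP
  exact not_isSoluble_two_of_padicInt_charts (padicInt_two_sq_ne_of_zmodPow 5 c) (padicInt_two_sq_ne_of_zmodPow 5 c')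

/-! ## §2 The classes `p`, `−7p` of `S′(W)` at `(q, p) ≡ (3, 5) (mod 8)` -/

section Classes
variable {q p : ℕ}

/-- Engine, common-then-square type: `d = p·d₁`, `d′ = p·q²·e₁`, `a = 84qp` ⇒ after `p ↦ 5` (common factor, `p ≡ 5 (8)`) and `q ↦ 3` on the `z`-side
(square factor, `q ≡ 3 (8)`) the class is the numeric quartic `(3·5·84; 5d₁, 9·5·e₁)`. [cite: Serre1973, Ch. II §3.3 Thm 4] -/
private theorem kill_common_sq_threeFive (hq8 : q % 8 = 3) (hp8 : p % 8 = 5) {a d d' d₁ e₁ : ℤ}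
    (ha : a = 84 * ((q : ℤ) * p)) (hd : d = p * d₁) (hd' : d' = (p : ℤ) * ((q : ℤ) ^ 2 * e₁))
    (hk : ¬ ((twoIsogenyQuartic (3 * (5 * 84)) (5 * d₁) (3 ^ 2 * (5 * e₁))).map (Int.castRingHom ℚ_[2])).IsSoluble) :
    ¬ ((twoIsogenyQuartic a d d').map (Int.castRingHom ℚ_[2])).IsSoluble := fun h ↦ by
  have h1 := isSoluble_two_of_common_factor (n := p) (n₀ := 5) (by omega) (a₀ := 84 * q) (d₀ := d₁) (e₀ := (q : ℤ) ^ 2 * e₁)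
    (by rw [ha]; ring) hd hd' h
  exact hk (isSoluble_two_of_sq_factor (n := q) (n₀ := 3) (by omega) (a₁ := 5 * 84) (e₁ := 5 * e₁) (by ring) (by ring) h1)

/-- **Class `p` of `S′`** (`d′ = −28q²p`), `(q, p) ≡ (3, 5) (mod 8)`: no `ℚ₂`-point. [cite: SilvermanAEC2009, Prop. X.4.9 and Example X.4.10] -/
theorem not_isSoluble_two_dual_P_threeFive (hq8 : q % 8 = 3) (hp8 : p % 8 = 5) {a d d' : ℤ} (ha : a = 84 * ((q : ℤ) * p))
    (hd : d = (p : ℤ)) (hd' : d' = -28 * ((q : ℤ) ^ 2 * p)) :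
    ¬ ((twoIsogenyQuartic a d d').map (Int.castRingHom ℚ_[2])).IsSoluble :=
  kill_common_sq_threeFive hq8 hp8 ha (d₁ := 1) (e₁ := -28) (by rw [hd]; ring) (by rw [hd']; ring)
    (by norm_num; exact not_isSoluble_two_normalised_P_threeFive)

/-- **Class `−7p` of `S′`** (`d′ = 4q²p`), `(q, p) ≡ (3, 5) (mod 8)`: no `ℚ₂`-point. [cite: SilvermanAEC2009, Prop. X.4.9 and Example X.4.10] -/
theorem not_isSoluble_two_dual_negSevenP_threeFive (hq8 : q % 8 = 3) (hp8 : p % 8 = 5) {a d d' : ℤ} (ha : a = 84 * ((q : ℤ) * p))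
    (hd : d = -7 * (p : ℤ)) (hd' : d' = 4 * ((q : ℤ) ^ 2 * p)) :
    ¬ ((twoIsogenyQuartic a d d').map (Int.castRingHom ℚ_[2])).IsSoluble :=
  kill_common_sq_threeFive hq8 hp8 ha (d₁ := -7) (e₁ := 4) (by rw [hd]; ring) (by rw [hd']; ring)
    (by norm_num; exact not_isSoluble_two_normalised_negSevenP_threeFive)

end Classes

/-! ## §3 The type-α kills at `p ≡ 5 (mod 8)`: classes `2p`, `−14p` of `S′(W)` -/

section AlphaKills
variable {q p : ℕ} [Fact p.Prime]

/-- **Type-α kill at `p`, class `2p ∈ S′(W)` (a35+)**: `d = p·2`, `d′ = p·(−14q²)`; a square root `T = X²` of `−14q²T² + 84qT + 2` gives the root `Z = irX`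
(`r² = q`, `i² = −1`) of `Q₅ = 7Z⁴ + 42Z² − 1`, root-free in type α at `p ≡ 5 (8)`. [cite: SilvermanAEC2009, Prop. X.4.9 and Example X.4.10] [cite: CoatesLiTianZhai2015, §5] -/
theorem not_isSoluble_padic_typeAlpha_class_twoP_five (hp8 : p % 8 = 5) (hp7 : legendreSym p (-7) = 1) (hα : ¬ ∃ x : ZMod p, x ^ 4 = -7)
    (hqsq : IsSquare ((q : ℤ) : ZMod p)) (him : IsSquare ((-1 : ℤ) : ZMod p)) (h2p0 : ((2 : ℤ) : ZMod p) ≠ 0)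
    (h14q2 : ((-14 * (q : ℤ) ^ 2 : ℤ) : ZMod p) ≠ 0)
    {d d' : ℤ} (hd : d = p * (2 : ℤ)) (hd' : d' = p * (-14 * (q : ℤ) ^ 2)) :
    ¬ ((twoIsogenyQuartic (84 * ((q : ℤ) * p)) d d').map (Int.castRingHom ℚ_[p])).IsSoluble := by
  refine not_isSoluble_padic_of_prime_dvd_coeffs_of_roots (p := p) (c := 84 * q) (e := (2 : ℤ)) (e' := -14 * (q : ℤ) ^ 2) (by ring) hd hd'
    h14q2 (fun T hT ↦ ?_)
  rintro ⟨X, rfl⟩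
  obtain ⟨r, hr⟩ := hqsq
  obtain ⟨i, hi⟩ := him
  push_cast at hr hi hT h2p0
  have h5 := (rootfree_Q5_Q6_of_alpha_five hp8 hp7 hα (i * r * X)).1
  apply h5
  have h2 : (2 : ZMod p) * (7 * (i * r * X) ^ 4 + 42 * (i * r * X) ^ 2 - 1) = 0 := by
    linear_combination (-1 : ZMod p) * hT + (-(14 * X ^ 4 * (i * i - 1) * r ^ 4 + 84 * X ^ 2 * r ^ 2)) * hi
      + (-(14 * X ^ 4 * (r * r + (q : ZMod p)) - 84 * X ^ 2)) * hr
  exact (mul_eq_zero.mp h2).resolve_left h2p0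

/-- **Type-α kill at `p`, class `−14p ∈ S′(W)` (a35+)**: `d = p·(−14)`, `d′ = p·(2q²)`; a square root `T = X²` of `2q²T² + 84qT − 14` gives the root `Z = irX`
of `Q₆ = Z⁴ − 42Z² − 7`, root-free in type α at `p ≡ 5 (8)`. [cite: SilvermanAEC2009, Prop. X.4.9 and Example X.4.10] [cite: CoatesLiTianZhai2015, §5] -/
theorem not_isSoluble_padic_typeAlpha_class_negFourteenP_five (hp8 : p % 8 = 5) (hp7 : legendreSym p (-7) = 1) (hα : ¬ ∃ x : ZMod p, x ^ 4 = -7)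
    (hqsq : IsSquare ((q : ℤ) : ZMod p)) (him : IsSquare ((-1 : ℤ) : ZMod p)) (h2p0 : ((2 : ℤ) : ZMod p) ≠ 0)
    (h2q2 : ((2 * (q : ℤ) ^ 2 : ℤ) : ZMod p) ≠ 0)
    {d d' : ℤ} (hd : d = p * (-14 : ℤ)) (hd' : d' = p * (2 * (q : ℤ) ^ 2)) :
    ¬ ((twoIsogenyQuartic (84 * ((q : ℤ) * p)) d d').map (Int.castRingHom ℚ_[p])).IsSoluble := by
  refine not_isSoluble_padic_of_prime_dvd_coeffs_of_roots (p := p) (c := 84 * q) (e := (-14 : ℤ)) (e' := 2 * (q : ℤ) ^ 2) (by ring) hd hd'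
    h2q2 (fun T hT ↦ ?_)
  rintro ⟨X, rfl⟩
  obtain ⟨r, hr⟩ := hqsq
  obtain ⟨i, hi⟩ := him
  push_cast at hr hi hT h2p0
  have h6 := (rootfree_Q5_Q6_of_alpha_five hp8 hp7 hα (i * r * X)).2
  apply h6
  have h2 : (2 : ZMod p) * ((i * r * X) ^ 4 - 42 * (i * r * X) ^ 2 - 7) = 0 := by
    linear_combination hT + (-(2 * X ^ 4 * (i * i - 1) * r ^ 4 - 84 * X ^ 2 * r ^ 2)) * hi
      + (-(2 * X ^ 4 * (r * r + (q : ZMod p)) + 84 * X ^ 2)) * hr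
  exact (mul_eq_zero.mp h2).resolve_left h2p0

end AlphaKills

end Summit.BirchSwinnertonDyer.BirchSwinnertonDyer.Theorems.GoldfeldGoodTwists

end
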